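import Literature.Topology.CoveringSpaces.CoveringMonodromyStabilizer
import Literature.AlgebraicTopology.FundamentalGroup.MapOfEqRange
import HarnessLib

/-!
# Classification of path-connected coverings by `p_* π₁` (Hatcher, §1.3, Prop. 1.37, Thm. 1.38 — injective half, and the ordering remark)

Topic `Literature/Topology/CoveringSpaces`; campaign-L R1 (topological Galois correspondence for
covering maps), part (B) «connected covers», file 2. Everything is PROVED from Mathlib's lifting
criterion `IsCoveringMap.existsUnique_continuousMap_lifts_of_range_le` (Hatcher, Prop. 1.33) and
unique lifting `IsCoveringMap.eq_of_comp_eq` (Prop. 1.34), plus the monodromy book-keeping of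
`CoveringMonodromyStabilizer` (file 1); no definition, no named fact.

Conventions as in file 1: coverings are unbundled `hpᵢ : IsCoveringMap pᵢ`, `pᵢ : Eᵢ → X`; a
*morphism of covers* is a continuous `f : E₁ → E₂` with `∀ e, p₂ (f e) = p₁ e`; an *isomorphism of
covers* is a homeomorphism `f : E₁ ≃ₜ E₂` with the same property; `p_* π₁(E, e)` is
`(FundamentalGroup.mapOfEq ⟨p, hp.continuous⟩ e.2).range ≤ π₁(X, x)` for `e : p ⁻¹' {x}`.

* `range_mapOfEq_le_of_map`, `range_mapOfEq_eq_of_homeomorph` — a pointed morphism of covers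
  `(E₁, e₁) → (E₂, e₂)` forces `p₁_* π₁(E₁, e₁) ≤ p₂_* π₁(E₂, e₂)`, an isomorphism forces equality
  (functoriality of `π₁`);
* `exists_map_iff_range_mapOfEq_le` — **the ordering of coverings** (Hatcher, remark after
  Thm. 1.38, p. 67): for `E₁` path connected and locally path connected, a pointed morphism
  `(E₁, e₁) → (E₂, e₂)` EXISTS iff `p₁_* π₁(E₁, e₁) ≤ p₂_* π₁(E₂, e₂)`, and it is unique
  (`map_unique`, Prop. 1.34);
* `exists_homeomorph_of_range_mapOfEq_eq` — **Prop. 1.37**: two coverings with path-connected,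
  locally path-connected total spaces and base points `e₁, e₂` over `x` with
  `p₁_* π₁(E₁, e₁) = p₂_* π₁(E₂, e₂)` are isomorphic by an isomorphism taking `e₁` to `e₂`;
  with the converse, `exists_homeomorph_apply_eq_iff_range_mapOfEq_eq` (Thm. 1.38, injectivity of
  «pointed covers ↦ subgroups»);
* `exists_homeomorph_of_range_mapOfEq_eq_map_conj`, `exists_homeomorph_iff_exists_conj` —
  **unpointed form**: they are isomorphic over `X` iff the two subgroups are conjugate in
  `π₁(X, x)` (Thm. 1.38, injectivity of «covers ↦ conjugacy classes»);
* `natCard_fiber_eq_of_homeomorph` — isomorphic coverings have the same number of sheets.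

The surjectivity halves of Thm. 1.38 (every subgroup / conjugacy class is realised) are the
sequel «(C)» of this campaign (associated coverings `(X̃ × S)/π₁`), not this file.

## References

* A. Hatcher, *Algebraic Topology*, CUP 2002, §1.3: Props. 1.33, 1.34 (pp. 61–62), Prop. 1.37,
  Thm. 1.38 and the remark on the partial ordering (pp. 67–68). [HatcherAT2002]
-/

noncomputable section

open Function

namespace Literature.Topology.CoveringSpaces

namespace ConnectedCover

open Literature.AlgebraicTopology.FundamentalGroup CoverMonodromy

variable {E₁ E₂ X : Type*} [TopologicalSpace E₁] [TopologicalSpace E₂] [TopologicalSpace X]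
  {p₁ : E₁ → X} {p₂ : E₂ → X}

/-! ### §1 Functoriality: morphisms of covers shrink `p_* π₁`, isomorphisms preserve it -/

/-- Transport of `mapOfEq` along an equality of continuous maps (the base-point proof is carried
along; base-point book-keeping for induced homomorphisms, Hatcher §1.1, p. 34, `(φψ)_* = φ_*ψ_*`).
[cite: HatcherAT2002, §1.1 p. 34 (induced homomorphisms)] -/
theorem mapOfEq_congr_map {q q' : C(E₁, X)} (hq : q = q') {a : E₁} {x : X} (h : q a = x)
    (γ : FundamentalGroup E₁ a) :
    FundamentalGroup.mapOfEq q h γ = FundamentalGroup.mapOfEq q' (hq ▸ h) γ := by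
  subst hq
  rfl

/-- A pointed morphism of covers `f : (E₁, e₁) → (E₂, e₂)` over `X` gives
`p₁_* π₁(E₁, e₁) ≤ p₂_* π₁(E₂, e₂)` (since `p₁_* = p₂_* ∘ f_*`).
[cite: HatcherAT2002, §1.3 remark after Thm. 1.38] -/
theorem range_mapOfEq_le_of_map (hp₁ : IsCoveringMap p₁) (hp₂ : IsCoveringMap p₂) {f : E₁ → E₂}
    (hfc : Continuous f) (hf : ∀ e, p₂ (f e) = p₁ e) {x : X} (e₁ : p₁ ⁻¹' {x}) (e₂ : p₂ ⁻¹' {x})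
    (he : f e₁ = e₂) :
    (FundamentalGroup.mapOfEq ⟨p₁, hp₁.continuous⟩ e₁.2).range ≤
      (FundamentalGroup.mapOfEq ⟨p₂, hp₂.continuous⟩ e₂.2).range := by
  have hq : (⟨p₁, hp₁.continuous⟩ : C(E₁, X)) =
      (⟨p₂, hp₂.continuous⟩ : C(E₂, X)).comp ⟨f, hfc⟩ :=
    ContinuousMap.ext fun e => (hf e).symm
  rintro _ ⟨δ, rfl⟩
  refine ⟨FundamentalGroup.mapOfEq ⟨f, hfc⟩ he δ, ?_⟩
  rw [mapOfEq_congr_map hq e₁.2 δ, ← mapOfEq_comp_apply ⟨f, hfc⟩ ⟨p₂, hp₂.continuous⟩ he e₂.2 δ]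

/-- A pointed ISOMORPHISM of covers preserves `p_* π₁`:
`p₁_* π₁(E₁, e₁) = p₂_* π₁(E₂, f e₁)`. [cite: HatcherAT2002, §1.3 Prop. 1.37] -/
theorem range_mapOfEq_eq_of_homeomorph (hp₁ : IsCoveringMap p₁) (hp₂ : IsCoveringMap p₂)
    (f : E₁ ≃ₜ E₂) (hf : ∀ e, p₂ (f e) = p₁ e) {x : X} (e₁ : p₁ ⁻¹' {x}) (e₂ : p₂ ⁻¹' {x})
    (he : f e₁ = e₂) :
    (FundamentalGroup.mapOfEq ⟨p₁, hp₁.continuous⟩ e₁.2).range =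
      (FundamentalGroup.mapOfEq ⟨p₂, hp₂.continuous⟩ e₂.2).range := by
  refine le_antisymm (range_mapOfEq_le_of_map hp₁ hp₂ f.continuous hf e₁ e₂ he)
    (range_mapOfEq_le_of_map hp₂ hp₁ f.symm.continuous (fun e => ?_) e₂ e₁ ?_)
  · rw [← hf (f.symm e), f.apply_symm_apply]
  · rw [← he, f.symm_apply_apply]

/-! ### §2 The ordering of coverings: existence and uniqueness of pointed morphisms -/

/-- From an inequality of ranges at base point `x` to the form of the hypothesis of Mathlib's
lifting criterion (ranges at base point `p₁ e₁`; Hatcher, Prop. 1.33, hypothesis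
`f_*(π₁(Y, y₀)) ⊂ p_*(π₁(X̃, x̃₀))`). [cite: HatcherAT2002, §1.3 Prop. 1.33] -/
theorem range_map_le_range_mapOfEq_of_le {q₁ : C(E₁, X)} {q₂ : C(E₂, X)} {a : E₁} {b : E₂}
    {x : X} (h₁ : q₁ a = x) (h₂ : q₂ b = x)
    (h : (FundamentalGroup.mapOfEq q₁ h₁).range ≤ (FundamentalGroup.mapOfEq q₂ h₂).range) :
    (FundamentalGroup.map q₁ a).range ≤ (FundamentalGroup.mapOfEq q₂ (h₂.trans h₁.symm)).range := by
  subst h₁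
  rintro _ ⟨δ, rfl⟩
  obtain ⟨δ', hδ'⟩ := h ⟨δ, rfl⟩
  exact ⟨δ', by rw [hδ', mapOfEq_rfl_apply]⟩

/-- **Existence of a pointed morphism of covers** (lifting criterion, Hatcher Prop. 1.33, and the
ordering remark after Thm. 1.38): if `E₁` is path connected and locally path connected and
`p₁_* π₁(E₁, e₁) ≤ p₂_* π₁(E₂, e₂)`, there is a continuous `f : E₁ → E₂` over `X` with
`f e₁ = e₂`. [cite: HatcherAT2002, §1.3 Prop. 1.33] -/
theorem exists_map_of_range_mapOfEq_le [PathConnectedSpace E₁] [LocallyPathConnectedSpace E₁]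
    (hp₁ : IsCoveringMap p₁) (hp₂ : IsCoveringMap p₂) {x : X} (e₁ : p₁ ⁻¹' {x}) (e₂ : p₂ ⁻¹' {x})
    (h : (FundamentalGroup.mapOfEq ⟨p₁, hp₁.continuous⟩ e₁.2).range ≤
      (FundamentalGroup.mapOfEq ⟨p₂, hp₂.continuous⟩ e₂.2).range) :
    ∃ f : E₁ → E₂, Continuous f ∧ (∀ e, p₂ (f e) = p₁ e) ∧ f e₁ = e₂ := by
  obtain ⟨F, ⟨hF0, hF⟩, -⟩ := hp₂.existsUnique_continuousMap_lifts_of_range_le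
    (f := ⟨p₁, hp₁.continuous⟩) (a₀ := (e₁ : E₁)) (e₀ := (e₂ : E₂)) (e₂.2.trans e₁.2.symm)
    (range_map_le_range_mapOfEq_of_le (q₁ := ⟨p₁, hp₁.continuous⟩) (q₂ := ⟨p₂, hp₂.continuous⟩)
      (a := (e₁ : E₁)) (b := (e₂ : E₂)) e₁.2 e₂.2 h)
  exact ⟨F, F.continuous, fun e => congr_fun hF e, hF0⟩

/-- **Uniqueness of morphisms of covers** (Hatcher, Prop. 1.34): two continuous maps
`E₁ → E₂` over `X` from a connected `E₁` that agree at one point are equal.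
[cite: HatcherAT2002, §1.3 Prop. 1.34] -/
theorem map_unique [PreconnectedSpace E₁] (hp₂ : IsCoveringMap p₂) {f g : E₁ → E₂}
    (hfc : Continuous f) (hgc : Continuous g) (hf : ∀ e, p₂ (f e) = p₁ e)
    (hg : ∀ e, p₂ (g e) = p₁ e) {a : E₁} (ha : f a = g a) : f = g :=
  hp₂.eq_of_comp_eq hfc hgc (funext fun e => (hf e).trans (hg e).symm) a ha

/-- The ordering of coverings (Hatcher, remark after Thm. 1.38): for `E₁` path connected and
locally path connected, a pointed morphism `(E₁, e₁) → (E₂, e₂)` over `X` exists iff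
`p₁_* π₁(E₁, e₁) ≤ p₂_* π₁(E₂, e₂)`. [cite: HatcherAT2002, §1.3 remark after Thm. 1.38] -/
theorem exists_map_iff_range_mapOfEq_le [PathConnectedSpace E₁] [LocallyPathConnectedSpace E₁]
    (hp₁ : IsCoveringMap p₁) (hp₂ : IsCoveringMap p₂) {x : X} (e₁ : p₁ ⁻¹' {x})
    (e₂ : p₂ ⁻¹' {x}) :
    (∃ f : E₁ → E₂, Continuous f ∧ (∀ e, p₂ (f e) = p₁ e) ∧ f e₁ = e₂) ↔
      (FundamentalGroup.mapOfEq ⟨p₁, hp₁.continuous⟩ e₁.2).range ≤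
        (FundamentalGroup.mapOfEq ⟨p₂, hp₂.continuous⟩ e₂.2).range :=
  ⟨fun ⟨_, hfc, hf, he⟩ => range_mapOfEq_le_of_map hp₁ hp₂ hfc hf e₁ e₂ he,
    exists_map_of_range_mapOfEq_le hp₁ hp₂ e₁ e₂⟩

/-! ### §3 Prop. 1.37: equal subgroups give isomorphic pointed coverings -/

/-- **Hatcher, Prop. 1.37**: if two coverings `p₁ : E₁ → X`, `p₂ : E₂ → X` have path-connected,
locally path-connected total spaces and `p₁_* π₁(E₁, e₁) = p₂_* π₁(E₂, e₂)` for base points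
`e₁, e₂` over the same `x`, then there is a homeomorphism `f : E₁ ≃ₜ E₂` over `X` with
`f e₁ = e₂` (the two lifts given by the lifting criterion are mutually inverse by unique lifting).
[cite: HatcherAT2002, §1.3 Prop. 1.37] -/
theorem exists_homeomorph_of_range_mapOfEq_eq
    [PathConnectedSpace E₁] [LocallyPathConnectedSpace E₁]
    [PathConnectedSpace E₂] [LocallyPathConnectedSpace E₂]
    (hp₁ : IsCoveringMap p₁) (hp₂ : IsCoveringMap p₂) {x : X} (e₁ : p₁ ⁻¹' {x}) (e₂ : p₂ ⁻¹' {x})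
    (h : (FundamentalGroup.mapOfEq ⟨p₁, hp₁.continuous⟩ e₁.2).range =
      (FundamentalGroup.mapOfEq ⟨p₂, hp₂.continuous⟩ e₂.2).range) :
    ∃ f : E₁ ≃ₜ E₂, (∀ e, p₂ (f e) = p₁ e) ∧ f e₁ = e₂ := by
  obtain ⟨F, hFc, hF, hF0⟩ := exists_map_of_range_mapOfEq_le hp₁ hp₂ e₁ e₂ h.le
  obtain ⟨G, hGc, hG, hG0⟩ := exists_map_of_range_mapOfEq_le hp₂ hp₁ e₂ e₁ h.ge
  have hGF : G ∘ F = id :=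
    map_unique (p₁ := p₁) hp₁ (hGc.comp hFc) continuous_id
      (fun e => (hG (F e)).trans (hF e)) (fun _ => rfl) (a := (e₁ : E₁))
      (by rw [comp_apply, hF0, hG0, id])
  have hFG : F ∘ G = id :=
    map_unique (p₁ := p₂) hp₂ (hFc.comp hGc) continuous_id
      (fun e => (hF (G e)).trans (hG e)) (fun _ => rfl) (a := (e₂ : E₂))
      (by rw [comp_apply, hG0, hF0, id])
  exact ⟨⟨⟨F, G, fun e => congr_fun hGF e, fun e => congr_fun hFG e⟩, hFc, hGc⟩, hF, hF0⟩

/-- **Thm. 1.38, pointed injectivity**: two coverings with path-connected, locally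
path-connected total spaces are isomorphic by a base-point preserving isomorphism iff
`p₁_* π₁(E₁, e₁) = p₂_* π₁(E₂, e₂)`. [cite: HatcherAT2002, §1.3 Thm. 1.38] -/
theorem exists_homeomorph_apply_eq_iff_range_mapOfEq_eq
    [PathConnectedSpace E₁] [LocallyPathConnectedSpace E₁]
    [PathConnectedSpace E₂] [LocallyPathConnectedSpace E₂]
    (hp₁ : IsCoveringMap p₁) (hp₂ : IsCoveringMap p₂) {x : X} (e₁ : p₁ ⁻¹' {x})
    (e₂ : p₂ ⁻¹' {x}) :
    (∃ f : E₁ ≃ₜ E₂, (∀ e, p₂ (f e) = p₁ e) ∧ f e₁ = e₂) ↔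
      (FundamentalGroup.mapOfEq ⟨p₁, hp₁.continuous⟩ e₁.2).range =
        (FundamentalGroup.mapOfEq ⟨p₂, hp₂.continuous⟩ e₂.2).range :=
  ⟨fun ⟨f, hf, he⟩ => range_mapOfEq_eq_of_homeomorph hp₁ hp₂ f hf e₁ e₂ he,
    exists_homeomorph_of_range_mapOfEq_eq hp₁ hp₂ e₁ e₂⟩

/-! ### §4 Unpointed form: conjugate subgroups give isomorphic coverings -/

/-- **Prop. 1.37 / Thm. 1.38, unpointed**: if `p₂_* π₁(E₂, e₂)` is the conjugate
`γ · p₁_* π₁(E₁, e₁) · γ⁻¹` for some `γ ∈ π₁(X, x)`, the coverings are isomorphic over `X` (move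
the base point of `E₁` to `γ • e₁`, whose subgroup is that conjugate, and apply Prop. 1.37).
[cite: HatcherAT2002, §1.3 Thm. 1.38] -/
theorem exists_homeomorph_of_range_mapOfEq_eq_map_conj
    [PathConnectedSpace E₁] [LocallyPathConnectedSpace E₁]
    [PathConnectedSpace E₂] [LocallyPathConnectedSpace E₂]
    (hp₁ : IsCoveringMap p₁) (hp₂ : IsCoveringMap p₂) {x : X} (e₁ : p₁ ⁻¹' {x}) (e₂ : p₂ ⁻¹' {x})
    (γ : FundamentalGroup X x)
    (h : (FundamentalGroup.mapOfEq ⟨p₂, hp₂.continuous⟩ e₂.2).range =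
      (FundamentalGroup.mapOfEq ⟨p₁, hp₁.continuous⟩ e₁.2).range.map (MulAut.conj γ).toMonoidHom) :
    ∃ f : E₁ ≃ₜ E₂, (∀ e, p₂ (f e) = p₁ e) ∧ f (hp₁.monodromy γ e₁) = e₂ :=
  exists_homeomorph_of_range_mapOfEq_eq hp₁ hp₂ (hp₁.monodromy γ e₁) e₂
    (by rw [range_mapOfEq_monodromy_eq_map_conj hp₁ e₁ γ, h])

/-- An (unpointed) isomorphism of coverings over `X` forces the subgroups at any two base points
over `x` to be conjugate (`E₂` path connected). [cite: HatcherAT2002, §1.3 Thm. 1.38] -/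
theorem exists_range_mapOfEq_eq_map_conj_of_homeomorph [PathConnectedSpace E₂]
    (hp₁ : IsCoveringMap p₁) (hp₂ : IsCoveringMap p₂) (f : E₁ ≃ₜ E₂) (hf : ∀ e, p₂ (f e) = p₁ e)
    {x : X} (e₁ : p₁ ⁻¹' {x}) (e₂ : p₂ ⁻¹' {x}) :
    ∃ γ : FundamentalGroup X x, (FundamentalGroup.mapOfEq ⟨p₂, hp₂.continuous⟩ e₂.2).range =
      (FundamentalGroup.mapOfEq ⟨p₁, hp₁.continuous⟩ e₁.2).range.map
        (MulAut.conj γ).toMonoidHom := by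
  let e₂' : p₂ ⁻¹' {x} := ⟨f e₁, by rw [Set.mem_preimage, hf]; exact e₁.2⟩
  obtain ⟨γ, hγ⟩ := exists_range_mapOfEq_eq_map_conj hp₂ e₂' e₂
  exact ⟨γ, by rw [hγ, ← range_mapOfEq_eq_of_homeomorph hp₁ hp₂ f hf e₁ e₂' rfl]⟩

/-- **Thm. 1.38, unpointed injectivity**: two coverings with path-connected, locally
path-connected total spaces are isomorphic over `X` iff `p₁_* π₁(E₁, e₁)` and `p₂_* π₁(E₂, e₂)`
(any base points over one `x`) are conjugate in `π₁(X, x)`. [cite: HatcherAT2002, §1.3 Thm. 1.38] -/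
theorem exists_homeomorph_iff_exists_conj
    [PathConnectedSpace E₁] [LocallyPathConnectedSpace E₁]
    [PathConnectedSpace E₂] [LocallyPathConnectedSpace E₂]
    (hp₁ : IsCoveringMap p₁) (hp₂ : IsCoveringMap p₂) {x : X} (e₁ : p₁ ⁻¹' {x})
    (e₂ : p₂ ⁻¹' {x}) :
    (∃ f : E₁ ≃ₜ E₂, ∀ e, p₂ (f e) = p₁ e) ↔
      ∃ γ : FundamentalGroup X x, (FundamentalGroup.mapOfEq ⟨p₂, hp₂.continuous⟩ e₂.2).range =
        (FundamentalGroup.mapOfEq ⟨p₁, hp₁.continuous⟩ e₁.2).range.map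
          (MulAut.conj γ).toMonoidHom :=
  ⟨fun ⟨f, hf⟩ => exists_range_mapOfEq_eq_map_conj_of_homeomorph hp₁ hp₂ f hf e₁ e₂,
    fun ⟨γ, hγ⟩ =>
      let ⟨f, hf, _⟩ := exists_homeomorph_of_range_mapOfEq_eq_map_conj hp₁ hp₂ e₁ e₂ γ hγ
      ⟨f, hf⟩⟩

/-! ### §5 Sheets -/

omit [TopologicalSpace X] in
/-- Isomorphic coverings have equipotent fibres (an isomorphism over `X` restricts to a bijection
of the fibres over each point). [cite: HatcherAT2002, §1.3 Thm. 1.38] -/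
theorem natCard_fiber_eq_of_homeomorph (f : E₁ ≃ₜ E₂) (hf : ∀ e, p₂ (f e) = p₁ e) (x : X) :
    Nat.card (p₁ ⁻¹' {x}) = Nat.card (p₂ ⁻¹' {x}) := by
  refine Nat.card_congr
    { toFun := fun e => ⟨f e, by rw [Set.mem_preimage, hf]; exact e.2⟩
      invFun := fun e => ⟨f.symm e, by
        rw [Set.mem_preimage, ← hf (f.symm e), f.apply_symm_apply]; exact e.2⟩
      left_inv := fun e => Subtype.ext (f.symm_apply_apply _)
      right_inv := fun e => Subtype.ext (f.apply_symm_apply _) }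

/-- Coverings with conjugate subgroups `p_* π₁` and path-connected total spaces have the same
number of sheets, namely the common index (Hatcher, Prop. 1.32 with Thm. 1.38).
[cite: HatcherAT2002, §1.3 Prop. 1.32] -/
theorem natCard_fiber_eq_of_range_mapOfEq_eq_map_conj [PathConnectedSpace E₁]
    [PathConnectedSpace E₂] (hp₁ : IsCoveringMap p₁) (hp₂ : IsCoveringMap p₂) {x : X}
    (e₁ : p₁ ⁻¹' {x}) (e₂ : p₂ ⁻¹' {x}) (γ : FundamentalGroup X x)
    (h : (FundamentalGroup.mapOfEq ⟨p₂, hp₂.continuous⟩ e₂.2).range =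
      (FundamentalGroup.mapOfEq ⟨p₁, hp₁.continuous⟩ e₁.2).range.map (MulAut.conj γ).toMonoidHom) :
    Nat.card (p₁ ⁻¹' {x}) = Nat.card (p₂ ⁻¹' {x}) := by
  rw [← index_range_mapOfEq_eq_natCard_fiber hp₂ e₂, h,
    ← range_mapOfEq_monodromy_eq_map_conj hp₁ e₁ γ, index_range_mapOfEq_eq_natCard_fiber hp₁]

end ConnectedCover

end Literature.Topology.CoveringSpaces
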